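import Literature.Geometry.GeometricMeasureTheory.SphericalMeasureImage
import Literature.Geometry.GeometricMeasureTheory.LowerDensityBound
import Literature.Geometry.GeometricMeasureTheory.IntegralCurrentsFlatCompactnessDimOne
import Literature.Geometry.GeometricMeasureTheory.CubicalPolyhedral
import HarnessLib

/-!
# The density of the blow-up limit is an integer

Support file for the proof of the named fact
`Literature.Geometry.GeometricMeasureTheory.Federer1969_compactness_integralCurrents` along
B. White's structure-theorem-free proof of the closure theorem, Step 5 of [White1989, p. 220]
("`θ(a)` is an integer"; [Bandara2006, proof of Thm. 4.2.1, p. 45]). At a good point the cone limit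
is `C = θ (𝓗^{k+1} ⌞ W) ∧ e₀ ∧ ⋯ ∧ e_k` for a `(k+1)`-plane `W` with orthonormal frame `e`, and
(`BlowUpSlicesRectifiable`) the boundary `Z = ∂(C ⌞ 𝐁(0, ρ))` of a ball piece is a rectifiable
`k`-current. This file concludes `θ ∈ ℤ`:

* fill `Z` by a rectifiable `(k+1)`-current `S` supported in `W ∩ 𝐁(0, ρ)` with `∂S = Z` — the cone
  over `Z` [Federer1969, 4.1.11] (`Current.IsRectifiable.cone_spec`) when `k ≥ 1`, a sum of
  segments from `0` to the finitely many points of `Z` when `k = 0` (`exists_rectifiable_filling`);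
* by the integer constancy theorem for rectifiable top-dimensional currents in a plane
  (`Current.IsRectifiable.exists_int_restrictSet_eq_face`, [Federer1969, 4.1.31 (2)]),
  `S ⌞ B(0, ρ) = a [B(0,ρ) ∩ W, e]` with `a ∈ ℤ`;
* the cycle `D = S − C ⌞ 𝐁(0, ρ)`, of finite mass and compact support, annihilates the form
  `χ e^♭` (`χ = 1` near its support): it is the boundary of its cone and `d(χ e^♭) = 0` there —
  quantitatively `|D(ψ_R)| ≤ const/R` for the dilated forms `ψ_R = e^♭ χ(·/R)`, all equal on `D`
  (`apply_smulCovector_eq_zero_of_cycle`, via `Current.abs_apply_le_of_cycle`);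
* evaluating, `(a − θ) 𝓗^{k+1}(W ∩ B(0, ρ)) = 0`, so `θ = a` (`exists_int_eq_of_isRectifiable_slice`).

## References

* B. White, *A new proof of the compactness theorem for integral currents*, Comment. Math. Helv.
  64 (1989) 207–220, Step 5, p. 220 [White1989].
* L. Bandara, *The closure theorem for integral currents without the structure theorem*,
  B.Sc. thesis, ANU 2006, proof of Thm. 4.2.1, p. 45 (held copy
  `lit paper:galaxy-pdf-8023002039701172160`) [Bandara2006].
* H. Federer, *Geometric Measure Theory*, Springer 1969, 4.1.7, 4.1.11, 4.1.28, 4.1.31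
  [Federer1969].
-/

noncomputable section

open scoped ENNReal NNReal Topology Distributions
open MeasureTheory TopologicalSpace Set Filter Metric Function

namespace Literature.Geometry.GeometricMeasureTheory

-- Nested operator-norm instances on (duals of) `E [⋀^Fin m]→L[ℝ] ℝ`, as in `Currents.lean`.
set_option maxSynthPendingDepth 3

variable {V : Type*} [NormedAddCommGroup V] [InnerProductSpace ℝ V] [FiniteDimensional ℝ V]
  [MeasurableSpace V] [BorelSpace V] {k : ℕ}

/-! ### Measure of a plane in balls and spheres -/

section PlaneMeasure

/-- `𝓗^{k+1}(W ∩ S(0, ρ)) = 0` for a `(k+1)`-plane `W`: the sphere of `W` is Lebesgue-null in `W`.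
[cite: Federer1969, 2.10.35] -/
theorem euclideanHausdorffMeasure_submodule_inter_sphere (W : Submodule ℝ V)
    (hdim : Module.finrank ℝ W = k + 1) (ρ : ℝ) :
    (μHE[k + 1] : Measure V) ((W : Set V) ∩ sphere 0 ρ) = 0 := by
  haveI : Nontrivial W := Module.nontrivial_of_finrank_eq_succ hdim
  set P := W.orthogonalProjectionOnto with hP
  have hsub : (W : Set V) ∩ sphere 0 ρ ⊆ P ⁻¹' sphere (0 : W) ρ ∩ {y : V | y - 0 ∈ W} := by
    rintro y ⟨hyW, hy⟩
    refine ⟨?_, by simpa using hyW⟩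
    rw [mem_preimage, mem_sphere, dist_zero_right]
    rw [mem_sphere, dist_zero_right] at hy
    have : (P y : V) = y := by
      rw [hP, ← Submodule.starProjection_apply, Submodule.starProjection_eq_self_iff]
      exact hyW
    rw [← this, Submodule.norm_coe] at hy
    exact hy
  refine measure_mono_null hsub ?_
  rw [← Measure.restrict_apply (isClosed_sphere.measurableSet.preimage P.continuous.measurable),
    euclideanHausdorffMeasure_restrict_plane_preimage W hdim (Submodule.zero_mem _)
      isClosed_sphere.measurableSet]
  exact Measure.addHaar_sphere volume (0 : W) ρ

/-- `𝓗^{k+1}(W ∩ B(0, ρ)) = α(k+1) ρ^{k+1}` for a `(k+1)`-plane `W` and `ρ ≥ 0`.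
[cite: Federer1969, 2.10.35, 2.7.16 (1)] -/
theorem euclideanHausdorffMeasure_submodule_inter_ball (W : Submodule ℝ V)
    (hdim : Module.finrank ℝ W = k + 1) {ρ : ℝ} (hρ : 0 ≤ ρ) :
    (μHE[k + 1] : Measure V) ((W : Set V) ∩ ball 0 ρ) =
      unitBallVolume (k + 1) * ENNReal.ofReal (ρ ^ (k + 1)) := by
  set P := W.orthogonalProjectionOnto with hP
  have heq : (W : Set V) ∩ ball 0 ρ = P ⁻¹' ball (0 : W) ρ ∩ {y : V | y - 0 ∈ W} := by
    ext y
    constructor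
    · rintro ⟨hyW, hy⟩
      refine ⟨?_, by simpa using hyW⟩
      rw [mem_preimage, mem_ball, dist_zero_right]
      rw [mem_ball, dist_zero_right] at hy
      have : (P y : V) = y := by
        rw [hP, ← Submodule.starProjection_apply, Submodule.starProjection_eq_self_iff]
        exact hyW
      rw [← this, Submodule.norm_coe] at hy
      exact hy
    · rintro ⟨hy, hyW⟩
      have hyW' : y ∈ W := by simpa using hyW
      refine ⟨hyW', ?_⟩
      rw [mem_preimage, mem_ball, dist_zero_right] at hy
      have : (P y : V) = y := by
        rw [hP, ← Submodule.starProjection_apply, Submodule.starProjection_eq_self_iff]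
        exact hyW'
      rw [mem_ball, dist_zero_right, ← this, Submodule.norm_coe]
      exact hy
  rw [heq, ← Measure.restrict_apply (measurableSet_ball.preimage P.continuous.measurable),
    euclideanHausdorffMeasure_restrict_plane_preimage W hdim (Submodule.zero_mem _) measurableSet_ball,
    volume_ball_eq_unitBallVolume_mul W hdim hρ]

/-- `𝓗^{k+1}(W ∩ 𝐁(0, ρ)) < ∞`. [cite: Federer1969, 2.10.35] -/
theorem euclideanHausdorffMeasure_submodule_inter_closedBall_lt_top (W : Submodule ℝ V)
    (hdim : Module.finrank ℝ W = k + 1) (ρ : ℝ) :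
    (μHE[k + 1] : Measure V) ((W : Set V) ∩ closedBall 0 ρ) < ⊤ := by
  rw [inter_comm]
  refine (euclideanHausdorffMeasure_inter_le_sphericalGauge W hdim _).trans_lt ?_
  refine (sphericalGauge_le_of_subset_closedBall Subset.rfl).trans_lt ?_
  exact ENNReal.mul_lt_top (unitBallVolume_ne_top _).lt_top
    (ENNReal.pow_lt_top ENNReal.ofReal_lt_top)

end PlaneMeasure

/-! ### Evaluating plane currents on `χ e^♭` -/

section Evaluate

/-- The support of `(μ ⌞ A) ∧ F` lies in the closure of `A`. [cite: Federer1969, 4.1.7] -/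
theorem support_vectorCurrent_restrict_subset_closure {m : ℕ} {μ : Measure V}
    {F : V → Multivector V m} (hF : LocallyIntegrableOn F ((⊤ : Opens V) : Set V) μ)
    {A : Set V} (hA : MeasurableSet A) :
    (vectorCurrent (μ.restrict A) F : Current (⊤ : Opens V) m).support ⊆ closure A := by
  rw [← restrictSet_vectorCurrent hF hA]
  exact (isRepresentable_vectorCurrent hF).support_restrictSet_subset_closure hA

omit [FiniteDimensional ℝ V] in
/-- **`((μ) ∧ c e)(χ e^♭) = c ∫ χ dμ`** for an orthonormal frame `e` and a finite measure `μ`.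
[cite: Federer1969, 4.1.7, 1.7.5] -/
theorem vectorCurrent_const_apply_smulCovector {μ : Measure V} [IsFiniteMeasure μ]
    {e : Fin (k + 1) → V} (he : Orthonormal ℝ e) (c : ℝ) (χ : 𝓓((⊤ : Opens V), ℝ)) :
    (vectorCurrent μ (fun _ => c • frameVector e) : Current (⊤ : Opens V) (k + 1))
        (smulCovectorCLM (frameCovector e) χ) = c * ∫ x, χ x ∂μ := by
  have hloc : LocallyIntegrableOn (fun _ : V => c • frameVector e) ((⊤ : Opens V) : Set V) μ :=
    (integrable_const _).locallyIntegrable.locallyIntegrableOn _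
  rw [vectorCurrent_apply hloc, ← integral_const_mul]
  refine integral_congr_ae (Eventually.of_forall fun x => ?_)
  change (c • frameVector e) (smulCovectorCLM (frameCovector e) χ x) = c * χ x
  rw [smulCovectorCLM_apply]
  change c • frameVector e (χ x • frameCovector e) = c * χ x
  rw [frameVector_apply, ContinuousAlternatingMap.smul_apply, frameCovector_self he]
  simp only [smul_eq_mul, mul_one]

omit [FiniteDimensional ℝ V] in
/-- **`[A, a, e](χ e^♭) = a ∫_A χ d𝓗^{k+1}`** for a set `A` of finite measure, an orthonormal frame
`e` and an integer `a`. [cite: Federer1969, 4.1.28 (4), 1.7.5] -/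
theorem currentOfIntegration_const_apply_smulCovector {A : Set V}
    (hAfin : (μHE[k + 1] : Measure V) A ≠ ⊤) {e : Fin (k + 1) → V} (he : Orthonormal ℝ e) (a : ℤ)
    (χ : 𝓓((⊤ : Opens V), ℝ)) :
    (currentOfIntegration A (fun _ => a) (fun _ => e) : Current (⊤ : Opens V) (k + 1))
        (smulCovectorCLM (frameCovector e) χ) = a * ∫ x in A, χ x ∂(μHE[k + 1] : Measure V) := by
  haveI : IsFiniteMeasure ((μHE[k + 1] : Measure V).restrict A) := isFiniteMeasure_restrict.2 hAfin
  unfold currentOfIntegration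
  exact vectorCurrent_const_apply_smulCovector he (a : ℝ) χ

end Evaluate

/-! ### A compactly supported cycle of finite mass annihilates `χ ω₀` -/

section Flux

omit [MeasurableSpace V] [BorelSpace V] in
/-- **A localised cycle annihilates locally constant forms**: if `D` is a cycle of finite mass
supported in `𝐁(0, ρ)` and `χ = 1` on `B(0, R₁)`, `R₁ > ρ`, then `D(χ ω₀) = 0` for every constant
covector `ω₀` (`D` is the boundary of its cone, of mass `≤ 2ρ 2^{k+1} 𝐌(D)`, and `D(χ ω₀) = D(ψ_R)`
for the dilated forms `ψ_R(x) = (χ ω₀)(x/R)`, `R ≥ 1`, whose differentials are `O(1/R)`).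
[cite: Federer1969, 4.1.11; White1989, p. 220] -/
theorem apply_smulCovector_eq_zero_of_cycle {D : Current (⊤ : Opens V) (k + 1)} (hDm : D.mass ≠ ⊤)
    (hD0 : D.boundary = 0) {ρ : ℝ} (hρ : 0 < ρ) (hspt : D.support ⊆ closedBall 0 ρ)
    (ω₀ : Covector V (k + 1)) (χ : 𝓓((⊤ : Opens V), ℝ)) {R₁ : ℝ} (hR₁ : ρ < R₁)
    (hχ : ∀ x ∈ ball (0 : V) R₁, χ x = 1) :
    D (smulCovectorCLM ω₀ χ) = 0 := by
  set φ₁ : TestForm (⊤ : Opens V) (k + 1) := smulCovectorCLM ω₀ χ with hφ₁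
  obtain ⟨C₁, hC₁, hdφ₁⟩ := TestForm.exists_norm_le (TestForm.extDerivCLM φ₁)
  set M : ℝ := 2 * ρ * 2 ^ (k + 1) * C₁ * D.mass.toReal with hM
  have key : ∀ R : ℝ, 1 ≤ R → |D φ₁| ≤ M / R := by
    intro R hR
    have hR0 : 0 < R := by linarith
    obtain ⟨ψ, hψ⟩ := exists_testForm_dilate (0 : V) hR0 1 φ₁
    have hDψ : D ψ = D φ₁ := by
      rw [← sub_eq_zero, ← map_sub]
      refine D.apply_eq_zero_of_eqOn isOpen_ball (hspt.trans (closedBall_subset_ball hR₁))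
        fun x hx => ?_
      have hx' : R⁻¹ • x ∈ ball (0 : V) R₁ := by
        rw [mem_ball, dist_zero_right, norm_smul, Real.norm_of_nonneg (inv_nonneg.2 hR0.le)]
        rw [mem_ball, dist_zero_right] at hx
        calc R⁻¹ * ‖x‖ ≤ 1 * ‖x‖ :=
            mul_le_mul_of_nonneg_right (inv_le_one_of_one_le₀ hR) (norm_nonneg _)
          _ < R₁ := by rw [one_mul]; exact hx
      change ψ x - φ₁ x = 0
      rw [hψ x, one_smul, sub_zero, hφ₁, smulCovectorCLM_apply, smulCovectorCLM_apply, hχ _ hx',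
        hχ _ hx, sub_self]
    have hdψ : ∀ x, ‖TestForm.extDerivCLM ψ x‖ ≤ C₁ / R := by
      intro x
      rw [extDerivCLM_dilate_apply 0 R 1 φ₁ ψ hψ x, one_mul, norm_smul,
        Real.norm_of_nonneg (inv_nonneg.2 hR0.le), div_eq_inv_mul]
      exact mul_le_mul_of_nonneg_left (hdφ₁ _) (inv_nonneg.2 hR0.le)
    have h := Current.abs_apply_le_of_cycle hDm hD0 hρ hspt ψ (by positivity : 0 ≤ C₁ / R) hdψ
    rw [hDψ] at h
    calc |D φ₁| ≤ 2 * ρ * 2 ^ (k + 1) * (C₁ / R) * D.mass.toReal := h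
      _ = M / R := by rw [hM]; ring
  have hlim : Tendsto (fun n : ℕ => M / ((n : ℝ) + 1)) atTop (𝓝 0) := by
    have h := (tendsto_const_div_atTop_nhds_zero_nat M).comp (tendsto_add_atTop_nat 1)
    refine h.congr fun n => ?_
    simp only [Function.comp_apply, Nat.cast_add, Nat.cast_one]
  have hle : |D φ₁| ≤ 0 :=
    ge_of_tendsto' hlim fun n => key ((n : ℝ) + 1) (by linarith [n.cast_nonneg (α := ℝ)])
  exact abs_eq_zero.1 (le_antisymm hle (abs_nonneg _))

end Flux

/-! ### Rectifiable fillings of the slice -/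

section Filling

/-- **The cone over a rectifiable `(m+1)`-cycle supported in `W ∩ 𝐁(0, ρ)`** is a rectifiable
current supported in `W ∩ 𝐁(0, ρ)` with boundary the cycle (`W` a subspace, hence a closed cone).
[cite: Federer1969, 4.1.11] -/
theorem exists_isRectifiable_filling_succ {m : ℕ} (W : Submodule ℝ V) {ρ : ℝ} (hρ : 0 < ρ)
    {Z : Current (⊤ : Opens V) (m + 1)} (hZ : Z.IsRectifiable) (hZ0 : Z.boundary = 0)
    (hZW : Z.support ⊆ (W : Set V) ∩ closedBall 0 ρ) :
    ∃ S : Current (⊤ : Opens V) (m + 2), S.IsRectifiable ∧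
      S.support ⊆ (W : Set V) ∩ closedBall 0 ρ ∧ S.boundary = Z := by
  obtain ⟨χ, U, hU, hKU, hχ1, hχabs, hχR⟩ := exists_testFunction_eq_one_nhds_subset
    (Ω := (⊤ : Opens V)) (K := closedBall (0 : V) ρ) (N := ball 0 (ρ + 1)) (isCompact_closedBall _ _)
    isOpen_ball (fun _ _ => trivial) (closedBall_subset_ball (by linarith))
  obtain ⟨hKrect, hKsupp, -, hformula⟩ := hZ.cone_spec 0 (r := ρ) (R := ρ + 1) (by linarith) χ hU
    hKU hχ1 hχabs hχR (hZW.trans inter_subset_right)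
  set K := (Z.prodInterval 0 1).pushforward ⊤ (TestFunction.tensorCutoff timeCutoff χ)
    (contDiff_affineHomotopy (contDiff_const (c := (0 : V))) contDiff_id) with hK
  refine ⟨K, hKrect, subset_inter ?_ hKsupp, ?_⟩
  · refine ((Z.prodInterval 0 1).support_pushforward_subset _ _).trans
      (closure_minimal ?_ W.closed_of_finiteDimensional)
    rintro _ ⟨p, ⟨-, hp⟩, rfl⟩
    obtain ⟨-, hx⟩ := Z.support_prodInterval_subset 0 1 hp
    change (0 : V) + p.1 • (id p.2 - 0) ∈ (W : Set V)
    rw [zero_add, id, sub_zero]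
    exact W.smul_mem _ (hZW hx).1
  · rw [hZ0, Current.prodInterval_zero, Current.pushforward_zero, add_zero] at hformula
    exact hformula.symm

/-- **Segments filling a rectifiable `0`-current of total multiplicity `0` in `W ∩ 𝐁(0, ρ)`**: a
rectifiable `0`-current `Z = Σ nⱼ δ_{pⱼ}` supported in `W ∩ 𝐁(0, ρ)` with `Σ nⱼ = 0` is the boundary
of the rectifiable `1`-current `Σ nⱼ ⟦0, pⱼ⟧`, supported in `W ∩ 𝐁(0, ρ)`.
[cite: Federer1969, 4.1.11, 4.1.25] -/
theorem exists_isRectifiable_filling_zero (W : Submodule ℝ V) {ρ : ℝ} (hρ : 0 < ρ)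
    {Z : Current (⊤ : Opens V) 0} (hZ : Z.IsRectifiable)
    (hZW : Z.support ⊆ (W : Set V) ∩ closedBall 0 ρ)
    (hZ1 : ∀ θ : TestForm (⊤ : Opens V) 0, (∃ U : Set V, IsOpen U ∧ closedBall (0 : V) ρ ⊆ U ∧
      ∀ x ∈ U, θ x = frameCovector ![]) → Z θ = 0) :
    ∃ S : Current (⊤ : Opens V) 1, S.IsRectifiable ∧
      S.support ⊆ (W : Set V) ∩ closedBall 0 ρ ∧ S.boundary = Z := by
  classical
  obtain ⟨F, n, hFspt, hZF, -⟩ := hZ.exists_finset_eq_currentOfIntegration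
  -- total multiplicity zero
  have hsum : ∑ p ∈ F, (n p : ℝ) = 0 := by
    obtain ⟨χ, U, hU, hKU, hχ1, -⟩ := exists_testFunction_eq_one_nhds (Ω := (⊤ : Opens V))
      (isCompact_closedBall (0 : V) ρ) (subset_univ _)
    have h := hZ1 (smulCovectorCLM (frameCovector ![]) χ) ⟨U, hU, hKU, fun x hx => by
      rw [smulCovectorCLM_apply, hχ1 x hx, one_smul]⟩
    rw [hZF, currentOfIntegration_finset_apply] at h
    rw [← h]
    refine Finset.sum_congr rfl fun p hp => ?_
    have hp' : p ∈ closedBall (0 : V) ρ := (hZW (hFspt hp)).2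
    rw [smulCovectorCLM_apply, hχ1 p (hKU hp'), one_smul, frameCovector_apply]
    simp
  -- the segments
  choose S hSrect hSsupp hSmass hSbdry using fun p : V => exists_segmentCurrent (n p) (0 : V) p
  have hconv : Convex ℝ ((W : Set V) ∩ closedBall 0 ρ) := W.convex.inter (convex_closedBall 0 ρ)
  have h0mem : (0 : V) ∈ (W : Set V) ∩ closedBall 0 ρ := ⟨W.zero_mem, mem_closedBall_self hρ.le⟩
  refine ⟨∑ p ∈ F, S p, Current.IsRectifiable.finsetSum_top F S fun p _ => hSrect p,
    Current.support_finsetSum_subset F S fun p hp => (hSsupp p).trans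
      (hconv.segment_subset h0mem (hZW (hFspt hp))), ?_⟩
  rw [Current.boundary_finsetSum, hZF, currentOfIntegration_finset_eq_sum_singleton]
  simp_rw [hSbdry]
  rw [Finset.sum_sub_distrib, sub_eq_self]
  ext φ
  rw [_root_.sum_apply]
  simp_rw [currentOfIntegration_singleton_apply]
  rw [← Finset.sum_mul, hsum, zero_mul]
  rfl

end Filling

/-! ### The density is an integer -/

section Main

/-- **Integrality from a rectifiable filling**: let `W` be a `(k+1)`-plane with orthonormal frame
`e`, `C_W = (𝓗^{k+1} ⌞ W) ∧ c e` a cycle, `ρ > 0`, and `S` a rectifiable `(k+1)`-current supported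
in `W ∩ 𝐁(0, ρ)` with `∂S = ∂(C_W ⌞ 𝐁(0, ρ))`. Then `c ∈ ℤ`: by integer constancy
`S ⌞ B(0,ρ) = a[B(0,ρ) ∩ W, e]` (`a ∈ ℤ`), the cycle `S − C_W ⌞ 𝐁(0,ρ)` annihilates `χ e^♭`
(`χ = 1` near `𝐁(0, ρ)`), and evaluating gives `(a − c) 𝓗^{k+1}(W ∩ B(0, ρ)) = 0`.
[cite: White1989, p. 220; Federer1969, 4.1.31] -/
theorem exists_int_eq_of_isRectifiable_filling (W : Submodule ℝ V)
    (hdim : Module.finrank ℝ W = k + 1) {e : Fin (k + 1) → V} (he : Orthonormal ℝ e)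
    (heW : ∀ i, e i ∈ W) (c : ℝ) {ρ : ℝ} (hρ : 0 < ρ)
    (hC0 : (vectorCurrent ((μHE[k + 1] : Measure V).restrict W) (fun _ => c • frameVector e) :
      Current (⊤ : Opens V) (k + 1)).boundary = 0)
    {S : Current (⊤ : Opens V) (k + 1)} (hS : S.IsRectifiable)
    (hSW : S.support ⊆ (W : Set V) ∩ closedBall 0 ρ)
    (hSZ : S.boundary = (vectorCurrent (((μHE[k + 1] : Measure V).restrict W).restrict
      (closedBall 0 ρ)) (fun _ => c • frameVector e) : Current (⊤ : Opens V) (k + 1)).boundary) :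
    ∃ n : ℤ, c = n := by
  classical
  -- notation and finiteness
  set μW : Measure V := (μHE[k + 1] : Measure V).restrict W with hμW
  set η₀ : Multivector V (k + 1) := c • frameVector e with hη₀
  haveI hμWlf : IsLocallyFiniteMeasure μW := isLocallyFiniteMeasure_restrict_submodule W hdim
  have hWm : MeasurableSet (W : Set V) := W.closed_of_finiteDimensional.measurableSet
  have hloc : LocallyIntegrableOn (fun _ : V => η₀) ((⊤ : Opens V) : Set V) μW :=
    (locallyIntegrable_const η₀).locallyIntegrableOn _
  have hCWr : (vectorCurrent μW (fun _ => η₀) : Current (⊤ : Opens V) (k + 1)).IsRepresentable :=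
    isRepresentable_vectorCurrent hloc
  set Cρ : Current (⊤ : Opens V) (k + 1) :=
    vectorCurrent (μW.restrict (closedBall 0 ρ)) (fun _ => η₀) with hCρ
  have hCρeq : hCWr.restrictSet (closedBall 0 ρ) measurableSet_closedBall = Cρ :=
    restrictSet_vectorCurrent hloc measurableSet_closedBall
  have hμWB : μW (closedBall 0 ρ) = (μHE[k + 1] : Measure V) ((W : Set V) ∩ closedBall 0 ρ) := by
    rw [hμW, Measure.restrict_apply measurableSet_closedBall, inter_comm]
  have hμWBfin : μW (closedBall 0 ρ) < ⊤ := by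
    rw [hμWB]; exact euclideanHausdorffMeasure_submodule_inter_closedBall_lt_top W hdim ρ
  haveI hfinρ : IsFiniteMeasure (μW.restrict (closedBall 0 ρ)) :=
    ⟨by rw [Measure.restrict_apply_univ]; exact hμWBfin⟩
  have hlocρ : LocallyIntegrableOn (fun _ : V => η₀) ((⊤ : Opens V) : Set V)
      (μW.restrict (closedBall 0 ρ)) :=
    (integrable_const η₀).locallyIntegrable.locallyIntegrableOn _
  have hCρm : Cρ.mass ≠ ⊤ := by
    refine ne_top_of_le_ne_top ?_ (mass_vectorCurrent_le _ _)
    rw [lintegral_const, Measure.restrict_apply_univ]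
    exact ENNReal.mul_ne_top (by simp) hμWBfin.ne
  have hCρspt : Cρ.support ⊆ closedBall 0 ρ := by
    have h := support_vectorCurrent_restrict_subset_closure hloc (measurableSet_closedBall (x := (0 : V))
      (ε := ρ))
    rwa [closure_closedBall] at h
  -- the boundary of `Cρ` vanishes on forms supported in the open ball
  have hbdryC : ∀ φ : TestForm (⊤ : Opens V) k, tsupport ⇑φ ⊆ ball (0 : V) ρ →
      Cρ.boundary φ = 0 := by
    intro φ hφ
    rw [Current.boundary_apply, ← hCρeq]
    have hsplit := congrArg (fun T : Current (⊤ : Opens V) (k + 1) => T (TestForm.extDerivCLM φ))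
      (hCWr.restrictSet_add_compl (measurableSet_closedBall (x := (0 : V)) (ε := ρ)))
    rw [FunLike.coe_add, Pi.add_apply] at hsplit
    have hout : hCWr.restrictSet (closedBall 0 ρ)ᶜ measurableSet_closedBall.compl
        (TestForm.extDerivCLM φ) = 0 := by
      refine hCWr.restrictSet_apply_of_disjoint _ (Set.disjoint_left.2 fun x hx hxc => hxc ?_)
      exact ball_subset_closedBall (hφ (TestForm.tsupport_extDerivCLM_subset φ (subset_tsupport _ hx)))
    have hCW0 : (vectorCurrent μW (fun _ => η₀) : Current (⊤ : Opens V) (k + 1))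
        (TestForm.extDerivCLM φ) = 0 := by
      rw [← Current.boundary_apply, hC0]; rfl
    rw [hout, add_zero, hCW0] at hsplit
    exact hsplit
  -- representability of `S`
  obtain ⟨⟨WS, θS, ξS, hdS, hSeq⟩, hScpt⟩ := hS
  have hSr : S.IsRepresentable := hSeq ▸ hdS.isRepresentable
  -- integer constancy on the open ball
  have hplane : {x : V | x - 0 ∈ W} = (W : Set V) := by ext x; simp
  have hUc : IsPreconnected (ball (0 : V) ρ ∩ {x : V | x - 0 ∈ W}) := by
    rw [hplane]; exact ((convex_ball 0 ρ).inter W.convex).isPreconnected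
  have hfin' : (μHE[k + 1] : Measure V) (ball (0 : V) ρ ∩ (W : Set V)) ≠ ⊤ := by
    rw [inter_comm]
    exact (lt_of_le_of_lt (measure_mono (inter_subset_inter_right _ ball_subset_closedBall))
      (euclideanHausdorffMeasure_submodule_inter_closedBall_lt_top W hdim ρ)).ne
  have hfin : (μHE[k + 1] : Measure V) (ball (0 : V) ρ ∩ {x : V | x - 0 ∈ W}) ≠ ⊤ := by
    rw [hplane]; exact hfin'
  have hsupp : S.support ∩ ball (0 : V) ρ ⊆ {x : V | x - 0 ∈ W} := by
    rw [hplane]; exact fun x hx => (hSW hx.1).1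
  have hbdryS : ∀ φ : TestForm (⊤ : Opens V) k, tsupport ⇑φ ⊆ ball (0 : V) ρ → S.boundary φ = 0 := by
    intro φ hφ; rw [hSZ]; exact hbdryC φ hφ
  obtain ⟨a, ha⟩ := Current.IsRectifiable.exists_int_restrictSet_eq_face ⟨⟨WS, θS, ξS, hdS, hSeq⟩, hScpt⟩
    hSr W 0 hdim he heW isOpen_ball hUc hfin hsupp hbdryS
  rw [hplane] at ha
  -- the cycle `D = S − Cρ`
  set D : Current (⊤ : Opens V) (k + 1) := S - Cρ with hD
  have hD0 : D.boundary = 0 := by rw [hD, Current.boundary_sub, hSZ, sub_self]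
  have hSm : S.mass ≠ ⊤ := Current.IsRectifiable.mass_ne_top' ⟨⟨WS, θS, ξS, hdS, hSeq⟩, hScpt⟩
  have hDm : D.mass ≠ ⊤ :=
    ne_top_of_le_ne_top (ENNReal.add_ne_top.2 ⟨hSm, hCρm⟩) (Current.mass_sub_le_add S Cρ)
  have hDspt : D.support ⊆ closedBall 0 ρ :=
    (Current.support_sub_subset S Cρ).trans (union_subset (hSW.trans inter_subset_right) hCρspt)
  -- the cutoff `χ₁ = 1` on `B(0, ρ + 1)` and the flux identity `D(χ₁ e^♭) = 0`
  obtain ⟨χ₁, U₁, -, hKU₁, hχ₁1, -⟩ := exists_testFunction_eq_one_nhds (Ω := (⊤ : Opens V))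
    (isCompact_closedBall (0 : V) (ρ + 1)) (subset_univ _)
  have hχ₁ball : ∀ x ∈ ball (0 : V) (ρ + 1), χ₁ x = 1 := fun x hx =>
    hχ₁1 x (hKU₁ (ball_subset_closedBall hx))
  have hflux := apply_smulCovector_eq_zero_of_cycle hDm hD0 hρ hDspt (frameCovector e) χ₁
    (by linarith : ρ < ρ + 1) hχ₁ball
  -- the sphere is null, so `𝓗(W ∩ 𝐁(0,ρ)) = 𝓗(W ∩ B(0,ρ))`
  have hsphere := euclideanHausdorffMeasure_submodule_inter_sphere W hdim ρ
  have hballeq : (μHE[k + 1] : Measure V) ((W : Set V) ∩ closedBall 0 ρ) =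
      (μHE[k + 1] : Measure V) ((W : Set V) ∩ ball 0 ρ) := by
    refine le_antisymm ?_ (measure_mono (inter_subset_inter_right _ ball_subset_closedBall))
    calc (μHE[k + 1] : Measure V) ((W : Set V) ∩ closedBall 0 ρ)
        = (μHE[k + 1] : Measure V) ((W : Set V) ∩ ball 0 ρ ∪ (W : Set V) ∩ sphere 0 ρ) := by
          rw [← inter_union_distrib_left, ball_union_sphere]
      _ ≤ (μHE[k + 1] : Measure V) ((W : Set V) ∩ ball 0 ρ) +
          (μHE[k + 1] : Measure V) ((W : Set V) ∩ sphere 0 ρ) := measure_union_le _ _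
      _ = (μHE[k + 1] : Measure V) ((W : Set V) ∩ ball 0 ρ) := by rw [hsphere, add_zero]
  -- evaluate `Cρ(χ₁ e^♭) = c 𝓗(W ∩ B(0,ρ))`
  have hCval : Cρ (smulCovectorCLM (frameCovector e) χ₁) =
      c * ((μHE[k + 1] : Measure V) ((W : Set V) ∩ ball 0 ρ)).toReal := by
    rw [hCρ, hη₀, vectorCurrent_const_apply_smulCovector he c χ₁]
    congr 1
    have h1 : ∫ x, χ₁ x ∂(μW.restrict (closedBall 0 ρ)) =
        ∫ x in closedBall (0 : V) ρ, (1 : ℝ) ∂μW :=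
      setIntegral_congr_fun measurableSet_closedBall fun x hx =>
        hχ₁ball x (closedBall_subset_ball (by linarith) hx)
    rw [h1, setIntegral_const, smul_eq_mul, mul_one, Measure.real, hμWB, hballeq]
  -- evaluate `S(χ₁ e^♭) = a 𝓗(W ∩ B(0,ρ))`
  have hSval : S (smulCovectorCLM (frameCovector e) χ₁) =
      a * ((μHE[k + 1] : Measure V) ((W : Set V) ∩ ball 0 ρ)).toReal := by
    have hsplit := congrArg (fun T : Current (⊤ : Opens V) (k + 1) =>
      T (smulCovectorCLM (frameCovector e) χ₁)) (hSr.restrictSet_add_compl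
        (isOpen_ball (x := (0 : V)) (ε := ρ)).measurableSet)
    rw [FunLike.coe_add, Pi.add_apply] at hsplit
    -- the outer part vanishes: `‖S‖(B(0,ρ)ᶜ) = 0`
    have hvar0 : S.variation (ball (0 : V) ρ)ᶜ = 0 := by
      have h1 : S.variation ((ball (0 : V) ρ)ᶜ ∩ S.support) = 0 := by
        have hsub : (ball (0 : V) ρ)ᶜ ∩ S.support ⊆ (W : Set V) ∩ sphere 0 ρ := by
          rintro x ⟨hxb, hxs⟩
          refine ⟨(hSW hxs).1, ?_⟩
          have h2 := (hSW hxs).2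
          rw [← ball_union_sphere] at h2
          exact h2.resolve_left hxb
        refine measure_mono_null hsub ?_
        rw [hSeq]
        change (vectorCurrent ((μHE[k + 1] : Measure V).restrict WS)
          (fun x => (θS x : ℝ) • frameVector (ξS x)) : Current (⊤ : Opens V) (k + 1)).variation _ = 0
        rw [variation_vectorCurrent_eq hdS.2.2.2.1]
        simp only [Opens.coe_top, Measure.restrict_univ]
        exact withDensity_absolutelyContinuous _ _
          (nonpos_iff_eq_zero.1 ((Measure.restrict_le_self _).trans hsphere.le))
      have h2 : S.variation (((⊤ : Opens V) : Set V) \ S.support) = 0 := S.variation_sdiff_support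
      refine nonpos_iff_eq_zero.1 ?_
      calc S.variation (ball (0 : V) ρ)ᶜ
          ≤ S.variation ((ball (0 : V) ρ)ᶜ ∩ S.support ∪ (((⊤ : Opens V) : Set V) \ S.support)) :=
            measure_mono fun x hx => by
              by_cases hxs : x ∈ S.support
              · exact Or.inl ⟨hx, hxs⟩
              · exact Or.inr ⟨trivial, hxs⟩
        _ ≤ S.variation ((ball (0 : V) ρ)ᶜ ∩ S.support) +
            S.variation (((⊤ : Opens V) : Set V) \ S.support) := measure_union_le _ _
        _ = 0 := by rw [h1, h2, add_zero]
    have hout : hSr.restrictSet (ball (0 : V) ρ)ᶜ isOpen_ball.measurableSet.compl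
        (smulCovectorCLM (frameCovector e) χ₁) = 0 := by
      rw [hSr.restrictSet_congr_ae isOpen_ball.measurableSet.compl MeasurableSet.empty
        (ae_eq_empty.2 hvar0), hSr.restrictSet_empty]
      rfl
    rw [hout, add_zero, ha, currentOfIntegration_const_apply_smulCovector hfin' he a χ₁] at hsplit
    rw [← hsplit]
    congr 1
    have h1 : ∫ x in ball (0 : V) ρ ∩ (W : Set V), χ₁ x ∂(μHE[k + 1] : Measure V) =
        ∫ x in ball (0 : V) ρ ∩ (W : Set V), (1 : ℝ) ∂(μHE[k + 1] : Measure V) :=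
      setIntegral_congr_fun (isOpen_ball.measurableSet.inter hWm) fun x hx =>
        hχ₁ball x (ball_subset_ball (by linarith) hx.1)
    rw [h1, setIntegral_const, smul_eq_mul, mul_one, Measure.real, inter_comm]
  -- conclude
  have hDval : D (smulCovectorCLM (frameCovector e) χ₁) =
      S (smulCovectorCLM (frameCovector e) χ₁) - Cρ (smulCovectorCLM (frameCovector e) χ₁) := rfl
  rw [hDval, hSval, hCval, ← sub_mul] at hflux
  have hmpos : 0 < ((μHE[k + 1] : Measure V) ((W : Set V) ∩ ball 0 ρ)).toReal := by
    rw [euclideanHausdorffMeasure_submodule_inter_ball W hdim hρ.le, ENNReal.toReal_mul]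
    refine mul_pos (ENNReal.toReal_pos (unitBallVolume_ne_zero _) (unitBallVolume_ne_top _)) ?_
    rw [ENNReal.toReal_ofReal (by positivity)]
    positivity
  refine ⟨a, ?_⟩
  have := (mul_eq_zero.1 hflux).resolve_right hmpos.ne'
  linarith

omit [FiniteDimensional ℝ V] [MeasurableSpace V] [BorelSpace V] in
/-- The exterior derivative of a test form vanishes where the form is locally constant. [folklore] -/
private theorem extDerivCLM_eq_zero_of_eqOn {m : ℕ} (θ : TestForm (⊤ : Opens V) m) {U : Set V}
    (hU : IsOpen U) (ω : Covector V m) (hθ : ∀ x ∈ U, θ x = ω) {x : V} (hx : x ∈ U) :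
    TestForm.extDerivCLM θ x = 0 := by
  have hev : (⇑θ) =ᶠ[𝓝 x] (fun _ => ω) :=
    Filter.eventuallyEq_of_mem (hU.mem_nhds hx) fun y hy => hθ y hy
  rw [show TestForm.extDerivCLM θ x = extDeriv ⇑θ x from congrFun (TestForm.extDerivCLM_apply θ) x,
    hev.extDeriv_eq]
  ext v
  rw [extDeriv_apply (differentiableAt_const ω) v]
  simp

/-- **The density of the cone limit is an integer** ([White1989, Step 5]): for a `(k+1)`-plane `W`
with orthonormal frame `e`, a real `c` with `C_W = (𝓗^{k+1} ⌞ W) ∧ c e` a cycle, and `ρ > 0`: if the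
slice `∂(C_W ⌞ 𝐁(0, ρ))` is a rectifiable `k`-current, then `c ∈ ℤ` (fill the slice by the cone,
or by segments when `k = 0`, and apply `exists_int_eq_of_isRectifiable_filling`).
[cite: White1989, p. 220; Bandara2006, proof of Thm. 4.2.1, p. 45; Federer1969, 4.1.11, 4.1.31] -/
theorem exists_int_eq_of_isRectifiable_slice (W : Submodule ℝ V)
    (hdim : Module.finrank ℝ W = k + 1) {e : Fin (k + 1) → V} (he : Orthonormal ℝ e)
    (heW : ∀ i, e i ∈ W) (c : ℝ) {ρ : ℝ} (hρ : 0 < ρ)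
    (hC0 : (vectorCurrent ((μHE[k + 1] : Measure V).restrict W) (fun _ => c • frameVector e) :
      Current (⊤ : Opens V) (k + 1)).boundary = 0)
    (hZ : (vectorCurrent (((μHE[k + 1] : Measure V).restrict W).restrict (closedBall 0 ρ))
      (fun _ => c • frameVector e) : Current (⊤ : Opens V) (k + 1)).boundary.IsRectifiable) :
    ∃ n : ℤ, c = n := by
  -- the ball piece and its support
  set μW : Measure V := (μHE[k + 1] : Measure V).restrict W with hμW
  haveI : IsLocallyFiniteMeasure μW := isLocallyFiniteMeasure_restrict_submodule W hdim
  have hWm : MeasurableSet (W : Set V) := W.closed_of_finiteDimensional.measurableSet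
  set Cρ : Current (⊤ : Opens V) (k + 1) := vectorCurrent (μW.restrict (closedBall 0 ρ))
    (fun _ => c • frameVector e) with hCρ
  have hloc : LocallyIntegrableOn (fun _ : V => c • frameVector e) ((⊤ : Opens V) : Set V) μW :=
    (locallyIntegrable_const _).locallyIntegrableOn _
  have hmeas : μW.restrict (closedBall 0 ρ) = μW.restrict (closedBall 0 ρ ∩ (W : Set V)) := by
    rw [hμW, Measure.restrict_restrict measurableSet_closedBall,
      Measure.restrict_restrict (measurableSet_closedBall.inter hWm), inter_assoc, inter_self]
  have hCρspt : Cρ.support ⊆ (W : Set V) ∩ closedBall 0 ρ := by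
    have h := support_vectorCurrent_restrict_subset_closure hloc (measurableSet_closedBall.inter hWm)
      (A := closedBall (0 : V) ρ ∩ (W : Set V))
    rw [← hmeas, (isClosed_closedBall.inter W.closed_of_finiteDimensional).closure_eq, inter_comm] at h
    exact h
  have hZW : Cρ.boundary.support ⊆ (W : Set V) ∩ closedBall 0 ρ :=
    (Current.support_boundary_subset _).trans hCρspt
  -- a rectifiable filling of the slice
  obtain ⟨S, hS, hSW, hSZ⟩ : ∃ S : Current (⊤ : Opens V) (k + 1), S.IsRectifiable ∧
      S.support ⊆ (W : Set V) ∩ closedBall 0 ρ ∧ S.boundary = Cρ.boundary := by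
    cases k with
    | zero =>
      refine exists_isRectifiable_filling_zero W hρ hZ hZW fun θ ⟨U, hU, hBU, hθ⟩ => ?_
      rw [Current.boundary_apply]
      exact Cρ.apply_eq_zero_of_eqOn hU (hCρspt.trans (inter_subset_right.trans hBU))
        fun x hx => extDerivCLM_eq_zero_of_eqOn θ hU _ hθ hx
    | succ m =>
      exact exists_isRectifiable_filling_succ W hρ hZ (Current.boundary_boundary Cρ) hZW
  exact exists_int_eq_of_isRectifiable_filling W hdim he heW c hρ hC0 hS hSW hSZ

end Main

end Literature.Geometry.GeometricMeasureTheory
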